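import Literature.NumberTheory.EllipticCurves.NewformsRealCoefficients
import Literature.NumberTheory.EllipticCurves.ModularSymbolsEichlerShimuraHoldsProofs
import Literature.NumberTheory.EllipticCurves.ModularSymbolsManinDrinfeldGeneralProofs
import Literature.NumberTheory.EllipticCurves.PAdicLFunctionDistributionProofs
import HarnessLib

/-!
# Shimura's theorem on the periods of a newform over its coefficient field:
# `{∞, r}_f = q⁺ Ω⁺ + q⁻ Ω⁻ i`, `q^± ∈ K_f` (Shimura 1977, Thm. 1; Manin 1972 for `K_f = ℚ`)

Topic `NumberTheory/EllipticCurves` (trunk EllArithM; continuation of `ModularSymbolsPeriodHomology`,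
whose section `PeriodRank` does the case `K_f = ℚ`, and of `NewformsRealCoefficients`). Let
`f = ∑ aₙ qⁿ ∈ S₂(Γ₀(N))` be a normalised newform (`IsNewform0`) with coefficient field
`K_f = ℚ(aₙ : n ≥ 1)` (`coeffField f`, a number field contained in `ℝ`:
`IsNewform0.coeffField_le_realSubfield`). This file proves, with no hypothesis on `K_f`:

* `IsNewform0.exists_submodule_coeffField_finrank_le_two` — the period lattice
  `Λ_f = {⟨γ, f⟩ : γ ∈ Γ₀(N)}` lies in a `K_f`-subspace of `ℂ` of dimension `≤ 2`;
* `IsNewform0.exists_re_im_mem_span_periodLattice` — there are real `Ω⁺, Ω⁻ ≠ 0` with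
  `re z ∈ K_f Ω⁺`, `im z ∈ K_f Ω⁻` for every `z` in the `K_f`-span of `Λ_f`;
* `IsNewform0.exists_periods_eq_add_mul_I` — **every period `{∞, γ∞}_f` and every modular symbol
  `{∞, r}_f`, `r ∈ ℚ`, is `q⁺ Ω⁺ + q⁻ Ω⁻ i` with `q^± ∈ K_f`** (Shimura 1977, Thm. 1: the
  algebraicity of `L(1, f, χ)/(τ(χ̄) u^±)` over `K_f(χ)`, in its modular-symbol form; Cremona 1997,
  (2.10.1) "`⟨γ, f⟩ = (v⁺γ)x + (v⁻γ)yi`" for `K_f = ℚ`);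
* `IsNewform0.exists_plusSymbol_eq_mul`, `IsNewform0.exists_minusSymbol_eq_mul` — the `K_f`-versions
  of the Manin–Drinfeld rationality statements `IsNewform0.exists_rat_smul_plusPeriod`,
  `IsNewform0.exists_rat_smul_minusPeriod` of `ModularSymbols` (there for rational newforms):
  `plusSymbol f r ∈ K_f Ω⁺`, `minusSymbol f r ∈ K_f iΩ⁻`.

## The proof (Shimura 1971, Thm. 7.14 / §8.2 run over `K_f`; Cremona 1997, §2.10)

1. *Rank count over `K_f`* (`PeriodRank.exists_submodule_finrank_le_two_of_real`, the `K`-version of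
   `PeriodRank.exists_submodule_rat_finrank_le_two`). The period homology `H ⊆ S₂(Γ₀(N))^∨` is a
   full lattice `ℤφ₁ ⊕ ⋯ ⊕ ℤφₙ`, `(φᵢ)` a real basis (Eichler–Shimura for `X₀(N)`,
   `periodHomology_eq_span_basis_holds`), stable under the `T_p^∨` (`dualMap_heckeT_mem_periodHomology`).
   Put `H_K = ∑ K φᵢ` (`dim_K H_K ≤ n`). Evaluation at `f` is `K`-linear and kills
   `U_K = ∑_{p ∤ N} (T_p^∨ - a_p)(H_K) ⊆ H_K` (`T_p f = a_p f`, `a_p ∈ K`), and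
   `dim_K U_K ≥ dim_ℝ ℝU_K` *because `K ⊆ ℝ`* (`PeriodRank.finrank_real_span_le_finrank_of_real`),
   while `ℝU_K ⊇ ∑_p range(T_p^∨ - a_p)` is the annihilator of the joint eigenspace
   `⋂_{p ∤ N} ker(T_p - a_p) = ℂf` (multiplicity one on all of `S₂(Γ₀(N))`, Atkin–Lehner / Knapp
   Thm. 9.22, `mem_span_of_equiv_of_mem_newSubspace0`), of real codimension `2`. Hence
   `dim_K K Λ_f ≤ dim_K H_K - dim_K U_K ≤ n - (n - 2) = 2`.
2. *Real structure.* All `aₙ(f)` are real (`IsNewform0.cuspCoeff_im_eq_zero`), so `Λ̄_f = Λ_f`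
   (`conj_mem_periodLattice_of_im_eq_zero`) and the `K`-plane `R₀ = K Λ_f` splits as
   `re R₀ ⊕ i im R₀` with both pieces inside `R₀`; both are nonzero since `Λ_f` spans `ℂ` over `ℝ`
   (`periodLattice_span_eq_top` of `ModularSymbolsLattice`), so both are
   `K`-lines `K Ω⁺`, `K iΩ⁻`.
3. *Modular symbols* `{∞, r}_f` lie in `R₀` by the Manin–Drinfeld theorem
   (`exists_nsmul_modularSymbol_mem_periodLattice_holds`, `ModularSymbolsManinDrinfeldGeneralProofs`),
   and `plusSymbol = re`, `minusSymbol = i im` for real coefficients (`plusSymbol_eq_re_holds`,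
   `minusSymbol_eq_im_mul_I_holds`).

Everything used is a theorem of the tree; no named fact is introduced.

## References

* G. Shimura, *On the periods of modular forms*, Math. Ann. 229 (1977), 211–221, Thm. 1.
* G. Shimura, *Introduction to the arithmetic theory of automorphic functions* (1971), Thm. 3.48,
  Thm. 7.14, §8.2.
* Ju. I. Manin, *Parabolic points and zeta functions of modular curves*, Izv. Akad. Nauk SSSR 36
  (1972), Thm. 1.9, Cor. 3.6, §1.6.
* J. E. Cremona, *Algorithms for modular elliptic curves*, 2nd ed. (1997), §2.8, §2.10 (2.10.1).
* A. W. Knapp, *Elliptic curves* (1993), Thm. 9.22.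
-/

noncomputable section

open scoped MatrixGroups ModularForm ComplexConjugate

open Module Submodule CongruenceSubgroup

namespace Literature.NumberTheory.EllipticCurves.ModularForms

namespace PeriodRank

/-! ### `K`-structures for a real subfield `K ⊆ ℂ` and the rank count over `K` -/

variable (K : IntermediateField ℚ ℂ)

/-- For a *real* intermediate field `K ⊆ ℂ` (every element has vanishing imaginary part) the
`K`-action on a complex vector space is the real action of the real parts. [folklore] -/
theorem smul_eq_re_smul (hK : ∀ x : K, (x : ℂ).im = 0) {V : Type*} [AddCommGroup V] [Module ℂ V]
    (x : K) (v : V) : x • v = ((x : ℂ).re : ℝ) • v := by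
  rw [IntermediateField.smul_def, ← Complex.coe_smul]
  congr 1
  exact Complex.ext (by simp) (by simp [hK x])

/-- The real span of a finite-dimensional `K`-subspace `P` of a complex vector space, `K ⊆ ℝ` a
real subfield, has real dimension at most `dim_K P` (a `K`-basis of `P` spans it over `ℝ`). [folklore] -/
theorem finrank_real_span_le_finrank_of_real (hK : ∀ x : K, (x : ℂ).im = 0)
    {V : Type*} [AddCommGroup V] [Module ℂ V] (P : Submodule K V) [FiniteDimensional K P] :
    finrank ℝ (span ℝ (P : Set V)) ≤ finrank K P := by
  classical
  let b := Module.finBasis K P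
  let t : Finset V := Finset.univ.image fun i ↦ (b i : V)
  have hPt : (P : Set V) ⊆ span ℝ (t : Set V) := by
    intro x hx
    have hsum : (∑ i, b.repr ⟨x, hx⟩ i • b i : P) = ⟨x, hx⟩ := b.sum_repr ⟨x, hx⟩
    have hx' : x = ∑ i, ((b.repr ⟨x, hx⟩ i : ℂ).re : ℝ) • (b i : V) := by
      conv_lhs => rw [show x = ((⟨x, hx⟩ : P) : V) from rfl, ← hsum]
      rw [Submodule.coe_sum]
      refine Finset.sum_congr rfl fun i _ ↦ ?_
      rw [Submodule.coe_smul, smul_eq_re_smul K hK]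
    rw [hx']
    refine Submodule.sum_mem _ fun i _ ↦ Submodule.smul_mem _ _ (Submodule.subset_span ?_)
    simp [t]
  calc finrank ℝ (span ℝ (P : Set V))
      ≤ finrank ℝ (span ℝ (t : Set V)) := by
        apply Submodule.finrank_mono
        exact span_le.mpr hPt
    _ ≤ t.card := finrank_span_finset_le_card t
    _ ≤ Fintype.card (Fin (finrank K P)) := Finset.card_image_le.trans (by simp)
    _ = finrank K P := Fintype.card_fin _

/-- **Rank count over the coefficient field.** Let `S` be a complex vector space whose dual `S^∨`
contains a full lattice `L = ℤφ₁ ⊕ ⋯ ⊕ ℤφₙ` (`φ` a real basis of `S^∨`), stable under the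
transposes of a family of endomorphisms `Tᵢ` of `S`, and let `K ⊆ ℝ` be a real subfield of `ℂ`.
If `f ∈ S`, `f ≠ 0`, is a joint eigenvector `Tᵢ f = aᵢ f` with eigenvalues `aᵢ ∈ K` whose joint
eigenspace is the line `ℂf`, then the values `{φ(f) : φ ∈ L}` lie in a `K`-subspace of `ℂ` of
dimension `≤ 2`: with `H_K = Kφ₁ ⊕ ⋯ ⊕ Kφₙ` (`dim_K ≤ n`), evaluation at `f` kills
`U_K = ∑ᵢ (Tᵢ^∨ - aᵢ)(H_K) ⊆ H_K`, whose real span `∑ᵢ range(Tᵢ^∨ - aᵢ)` (finitely many `i`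
suffice) is the annihilator of `⋂ᵢ ker(Tᵢ - aᵢ) = ℂf`, of real codimension `2`, while
`dim_ℝ (ℝ U_K) ≤ dim_K U_K` because `K` is real (the case `K = ℚ` is
`exists_submodule_rat_finrank_le_two`; Shimura 1971, Thm. 7.14 / Shimura 1977, Thm. 1 for
general `K_f`). [folklore] -/
theorem exists_submodule_finrank_le_two_of_real (hK : ∀ x : K, (x : ℂ).im = 0)
    {S : Type*} [AddCommGroup S] [Module ℂ S]
    {n : ℕ} (b : Module.Basis (Fin n) ℝ (Module.Dual ℂ S))
    (L : AddSubgroup (Module.Dual ℂ S))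
    (hL : (L : Set (Module.Dual ℂ S)) = Submodule.span ℤ (Set.range b))
    {ι : Type*} (T : ι → S →ₗ[ℂ] S) (hT : ∀ i, ∀ φ ∈ L, (T i).dualMap φ ∈ L)
    (a : ι → ℂ) (haK : ∀ i, a i ∈ K) (f : S) (hf : f ≠ 0) (hTf : ∀ i, T i f = a i • f)
    (hM1 : ∀ h : S, (∀ i, T i h = a i • h) → h ∈ Submodule.span ℂ ({f} : Set S)) :
    ∃ R : Submodule K ℂ, FiniteDimensional K R ∧ Module.finrank K R ≤ 2 ∧
      ((L.map (LinearMap.applyₗ (R := ℂ) f).toAddMonoidHom : AddSubgroup ℂ) : Set ℂ) ⊆ R := by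
  classical
  -- finite-dimensionality of `S` follows from the finite real basis `b` of `S^∨`
  haveI hWfin : Module.Finite ℝ (Module.Dual ℂ S) := Module.Finite.of_basis b
  haveI hWfinC : Module.Finite ℂ (Module.Dual ℂ S) :=
    Module.Finite.of_restrictScalars_finite ℝ ℂ (Module.Dual ℂ S)
  haveI : FiniteDimensional ℂ S := (Module.finite_dual_iff ℂ).mp hWfinC
  -- the operators `φᵢ = Tᵢ - aᵢ`
  let φ : ι → S →ₗ[ℂ] S := fun i ↦ T i - a i • LinearMap.id
  have hφf : ∀ i, φ i f = 0 := by
    intro i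
    simp only [φ, LinearMap.sub_apply, LinearMap.smul_apply, LinearMap.id_apply, hTf i, sub_self]
  have hf_mem : ∀ i, f ∈ LinearMap.ker (φ i) := fun i ↦ hφf i
  -- their joint kernel is `ℂ f`, and finitely many of them suffice
  have hker_le : (⨅ i, LinearMap.ker (φ i)) ≤ Submodule.span ℂ ({f} : Set S) := by
    intro h hh
    rw [Submodule.mem_iInf] at hh
    refine hM1 h fun i ↦ ?_
    have := hh i
    rw [LinearMap.mem_ker] at this
    simpa only [φ, LinearMap.sub_apply, LinearMap.smul_apply, LinearMap.id_apply, sub_eq_zero]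
      using this
  obtain ⟨s, hs⟩ := exists_finset_iInf_eq fun i ↦ LinearMap.ker (φ i)
  let ψ : ↥s → S →ₗ[ℂ] S := fun i ↦ φ i
  have hEq : (⨅ i : ↥s, LinearMap.ker (ψ i)) = Submodule.span ℂ ({f} : Set S) := by
    apply le_antisymm
    · have : (⨅ i : ↥s, LinearMap.ker (ψ i)) = ⨅ i ∈ s, LinearMap.ker (φ i) := by
        rw [iInf_subtype']
      rw [this, ← hs]
      exact hker_le
    · rw [Submodule.span_singleton_le_iff_mem, Submodule.mem_iInf]
      exact fun i ↦ hf_mem i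
  have hfinE : finrank ℂ (⨅ i : ↥s, LinearMap.ker (ψ i) : Submodule ℂ S) = 1 := by
    rw [hEq, finrank_span_singleton hf]
  -- `U = ∑ᵢ range (Tᵢ - aᵢ)^∨` has complex codimension `1`, real codimension `2`
  let U : Submodule ℂ (Module.Dual ℂ S) := ⨆ i : ↥s, LinearMap.range (ψ i).dualMap
  have hUq : finrank ℂ (Module.Dual ℂ S ⧸ U) = 1 := by
    rw [finrank_dual_quotient_iSup_range_dualMap ψ, hfinE]
  have hUfin : finrank ℂ U + 1 = finrank ℂ (Module.Dual ℂ S) := by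
    have := Submodule.finrank_quotient_add_finrank U
    omega
  have hnW : finrank ℝ (Module.Dual ℂ S) = n := by simpa using Module.finrank_eq_card_basis b
  have h2W : finrank ℝ (Module.Dual ℂ S) = 2 * finrank ℂ (Module.Dual ℂ S) :=
    finrank_real_of_complex _
  let Uℝ : Submodule ℝ (Module.Dual ℂ S) := U.restrictScalars ℝ
  have hUℝ : finrank ℝ Uℝ = 2 * finrank ℂ U := by
    let eU : Uℝ ≃ₗ[ℝ] U :=
      { toFun := fun x ↦ ⟨x.1, x.2⟩
        invFun := fun x ↦ ⟨x.1, x.2⟩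
        map_add' := fun _ _ ↦ rfl
        map_smul' := fun _ _ ↦ rfl
        left_inv := fun _ ↦ rfl
        right_inv := fun _ ↦ rfl }
    rw [eU.finrank_eq, finrank_real_of_complex U]
  have hUℝ' : finrank ℝ Uℝ + 2 = n := by omega
  -- the `K`-structure `H_K = K φ₁ + ⋯ + K φₙ ⊇ L`
  let HK : Submodule K (Module.Dual ℂ S) := span K (Set.range b)
  haveI hHKfin : FiniteDimensional K HK := FiniteDimensional.span_of_finite K (Set.finite_range b)
  have hHKn : finrank K HK ≤ n := by
    have h := finrank_range_le_card (R := K) b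
    rwa [Fintype.card_fin] at h
  have hLm : ∀ x, x ∈ L ↔ x ∈ Submodule.span ℤ (Set.range b) := fun x ↦ by
    rw [← SetLike.mem_coe, hL, SetLike.mem_coe]
  have hbi : ∀ i, b i ∈ L := fun i ↦ (hLm _).mpr (Submodule.subset_span ⟨i, rfl⟩)
  have hZK : ∀ x ∈ Submodule.span ℤ (Set.range b), x ∈ HK := by
    intro x hx
    induction hx using Submodule.span_induction with
    | mem y hy => exact Submodule.subset_span hy
    | zero => exact zero_mem _
    | add y z _ _ hy hz => exact add_mem hy hz
    | smul c y _ hy => exact zsmul_mem hy c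
  have hLHK : ∀ x ∈ L, x ∈ HK := fun x hx ↦ hZK x ((hLm x).mp hx)
  -- (a) the `(Tᵢ - aᵢ)^∨` preserve `H_K` (stability of `L`, `aᵢ ∈ K`)
  have hφHK : ∀ i, ∀ x ∈ HK, (φ i).dualMap x ∈ HK := by
    intro i x hx
    induction hx using Submodule.span_induction with
    | mem y hy =>
      obtain ⟨j, rfl⟩ := hy
      have hsplit : (φ i).dualMap (b j) = (T i).dualMap (b j) - (⟨a i, haK i⟩ : K) • b j := by
        ext h
        simp only [φ, LinearMap.dualMap_apply, LinearMap.sub_apply, LinearMap.smul_apply,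
          LinearMap.id_apply, map_sub, map_smul, smul_eq_mul, IntermediateField.smul_def]
      rw [hsplit]
      exact sub_mem (hLHK _ (hT i _ (hbi j))) (Submodule.smul_mem _ _ (Submodule.subset_span ⟨j, rfl⟩))
    | zero => rw [map_zero]; exact zero_mem _
    | add y z _ _ hy hz => rw [map_add]; exact add_mem hy hz
    | smul c y _ hy => rw [LinearMap.map_smul_of_tower]; exact Submodule.smul_mem _ c hy
  -- (b) evaluation at `f`, a `K`-linear map killing `U_K = ∑ᵢ (Tᵢ - aᵢ)^∨ (H_K)`
  let E : Module.Dual ℂ S →ₗ[K] ℂ := (LinearMap.applyₗ (R := ℂ) f).restrictScalars K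
  have hEφ : ∀ i x, E ((φ i).dualMap x) = 0 := by
    intro i x
    change ((φ i).dualMap x) f = 0
    rw [LinearMap.dualMap_apply, hφf i, map_zero]
  let UK : Submodule K (Module.Dual ℂ S) :=
    ⨆ i : ↥s, HK.map (((ψ i).dualMap).restrictScalars K)
  have hUKHK : UK ≤ HK := by
    refine iSup_le fun i ↦ ?_
    rintro _ ⟨x, hx, rfl⟩
    exact hφHK i x hx
  haveI : FiniteDimensional K UK := Submodule.finiteDimensional_of_le hUKHK
  have hUKE : ∀ y ∈ UK, E y = 0 := by
    intro y hy
    induction hy using Submodule.iSup_induction' with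
    | mem i y hy =>
      obtain ⟨z, _, rfl⟩ := hy
      exact hEφ i z
    | zero => simp
    | add y z _ _ hy hz => rw [map_add, hy, hz, add_zero]
  -- (c) `dim_K U_K ≥ dim_ℝ (ℝ U_K) ≥ dim_ℝ U = n - 2`
  have hUle : Uℝ ≤ span ℝ (UK : Set (Module.Dual ℂ S)) := by
    intro y hy
    change y ∈ U at hy
    induction hy using Submodule.iSup_induction' with
    | mem i y hy =>
      obtain ⟨z, rfl⟩ := hy
      have hz : z ∈ span ℝ (Set.range b) := by rw [b.span_eq]; trivial
      have hmap : (span ℝ (Set.range b)).map (((ψ i).dualMap).restrictScalars ℝ) ≤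
          span ℝ (UK : Set (Module.Dual ℂ S)) := by
        rw [Submodule.map_span, Submodule.span_le]
        rintro _ ⟨_, ⟨j, rfl⟩, rfl⟩
        apply Submodule.subset_span
        change (ψ i).dualMap (b j) ∈ UK
        exact Submodule.mem_iSup_of_mem i ⟨b j, Submodule.subset_span ⟨j, rfl⟩, rfl⟩
      exact hmap ⟨z, hz, rfl⟩
    | zero => exact zero_mem _
    | add y z _ _ hy hz => exact add_mem hy hz
  have hUK : finrank ℝ Uℝ ≤ finrank K UK :=
    (Submodule.finrank_mono hUle).trans (finrank_real_span_le_finrank_of_real K hK UK)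
  -- (d) rank–nullity for `E` on `H_K`
  set g : HK →ₗ[K] ℂ := E.domRestrict HK with hg_def
  have hg : LinearMap.range g = HK.map E := LinearMap.range_domRestrict _ _
  have hrank : finrank K (LinearMap.range g) + finrank K (LinearMap.ker g) = finrank K HK :=
    LinearMap.finrank_range_add_finrank_ker g
  have hUker : UK.comap HK.subtype ≤ LinearMap.ker g := by
    intro x hx
    rw [LinearMap.mem_ker]
    exact hUKE _ hx
  have hU : finrank K UK ≤ finrank K (LinearMap.ker g) := by
    calc finrank K UK = finrank K (UK.comap HK.subtype) :=
          (LinearEquiv.finrank_eq (Submodule.comapSubtypeEquivOfLe hUKHK)).symm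
      _ ≤ finrank K (LinearMap.ker g) := Submodule.finrank_mono hUker
  refine ⟨HK.map E, inferInstance, ?_, ?_⟩
  · rw [← hg]
    omega
  · intro z hz
    obtain ⟨φ', hφ', rfl⟩ := AddSubgroup.mem_map.mp hz
    exact ⟨φ', hLHK _ hφ', rfl⟩

end PeriodRank


/-! ### Periods of a newform over its coefficient field -/

section NewformPeriods

open Complex

variable {N : ℕ} [NeZero N] {f : CuspForm (Gamma0 N) 2}

/-- **The periods of a newform span a `K_f`-plane.** For a normalised newform `f ∈ S₂(Γ₀(N))`
with coefficient field `K_f = ℚ(aₙ(f))` (a real number field, `IsNewform0.coeffField_le_realSubfield`),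
the period lattice `Λ_f = {⟨γ, f⟩ : γ ∈ Γ₀(N)}` lies in a `K_f`-subspace of `ℂ` of dimension `≤ 2`
(Shimura 1977, Thm. 1; Shimura 1971, Thm. 7.14 / (8.2) for `K_f = ℚ`): the period homology is a
full Hecke-stable lattice in `S₂(Γ₀(N))^∨` (Eichler–Shimura, `periodHomology_eq_span_basis_holds`,
`dualMap_heckeT_mem_periodHomology`), `T_p f = a_p f` with `a_p ∈ K_f` real, and the joint
eigenspace of the `T_p`, `p ∤ N`, for the eigenvalues of `f` is `ℂf` (multiplicity one on
`S₂(Γ₀(N))`, `mem_span_of_equiv_of_mem_newSubspace0`); now count ranks over `K_f`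
(`PeriodRank.exists_submodule_finrank_le_two_of_real`). [cite: Shimura1977, Thm. 1] -/
theorem IsNewform0.exists_submodule_coeffField_finrank_le_two (hf : IsNewform0 f) :
    ∃ R : Submodule (coeffField f) ℂ, FiniteDimensional (coeffField f) R ∧
      Module.finrank (coeffField f) R ≤ 2 ∧ (periodLattice f : Set ℂ) ⊆ R := by
  have hf0 : f ≠ 0 := IsNormalized.ne_zero_gamma0 hf.2.2
  obtain ⟨n, b, hb⟩ := periodHomology_eq_span_basis_holds N
  let P := {p : ℕ // p.Prime ∧ ¬ p ∣ N}
  let T : P → CuspForm (Gamma0 N) 2 →ₗ[ℂ] CuspForm (Gamma0 N) 2 := fun p ↦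
    haveI : NeZero (p : ℕ) := ⟨p.2.1.ne_zero⟩; heckeT (Gamma0 N) 2 p
  have hT : ∀ p : P, ∀ φ ∈ periodHomology N, (T p).dualMap φ ∈ periodHomology N :=
    fun p φ hφ ↦ by
      haveI : NeZero (p : ℕ) := ⟨p.2.1.ne_zero⟩
      exact dualMap_heckeT_mem_periodHomology N p.2.1 hφ
  have hTf : ∀ p : P, T p f = cuspCoeff f p • f := fun p ↦ by
    haveI : NeZero (p : ℕ) := ⟨p.2.1.ne_zero⟩
    exact hf.heckeT_eq_coeff_smul p.2.1
  have hM1 : ∀ h : CuspForm (Gamma0 N) 2, (∀ p : P, T p h = cuspCoeff f p • h) →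
      h ∈ Submodule.span ℂ ({f} : Set (CuspForm (Gamma0 N) 2)) := by
    intro h hh
    refine mem_span_of_equiv_of_mem_newSubspace0 (a := fun p ↦ cuspCoeff f p) hf0 hf.1
      (fun p hp _ ↦ ?_) h (fun p hp hpN ↦ ?_)
    · haveI : NeZero p := ⟨hp.ne_zero⟩
      exact hf.heckeT_eq_coeff_smul hp
    · exact hh ⟨p, hp, hpN⟩
  obtain ⟨R, hRfin, hR, hsub⟩ := PeriodRank.exists_submodule_finrank_le_two_of_real (coeffField f)
    (fun x ↦ hf.im_eq_zero_of_mem_coeffField x.2) b (periodHomology N) hb T hT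
    (fun p ↦ cuspCoeff f p) (fun p ↦ coeff_mem_coeffField f p) f hf0 hTf hM1
  refine ⟨R, hRfin, hR, ?_⟩
  rw [periodLattice_eq_map_periodHomology]
  exact hsub

/-- `Λ̄_f = Λ_f` whenever all Fourier coefficients of `f` are real (on generators
`conj {∞, γ∞}_f = {∞, γ'∞}_f`, `exists_cuspSymbol_eq_conj`; Manin 1972, §1.6; Cremona 1997, §2.6).
The case of rational newforms is `conj_mem_periodLattice_holds`. [cite: Manin1972, §1.6] -/
theorem conj_mem_periodLattice_of_im_eq_zero (h : ∀ n, (cuspCoeff f n).im = 0) {z : ℂ}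
    (hz : z ∈ periodLattice f) : starRingEnd ℂ z ∈ periodLattice f := by
  induction hz using AddSubgroup.closure_induction with
  | mem x hx =>
    obtain ⟨γ, rfl⟩ := hx
    obtain ⟨γ', hγ'⟩ := exists_cuspSymbol_eq_conj h γ
    rw [← hγ']
    exact cuspSymbol_mem_periodLattice f _
  | zero => rw [map_zero]; exact zero_mem _
  | add x y _ _ hx hy => rw [map_add]; exact add_mem hx hy
  | neg x _ hx => rw [map_neg]; exact neg_mem hx

/-- **Shimura's theorem on the periods of a newform, real and imaginary parts** (Shimura 1977,
Thm. 1; for `K_f = ℚ`: Manin 1972, Thm. 1.9/Cor. 3.6, Cremona 1997, (2.10.1)): for a normalised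
newform `f ∈ S₂(Γ₀(N))` with (real) coefficient field `K_f` there are real numbers `Ω⁺, Ω⁻ ≠ 0`
such that every element `z` of the `K_f`-span of the period lattice `Λ_f` has `re z ∈ K_f Ω⁺` and
`im z ∈ K_f Ω⁻`. Proof: the `K_f`-span `R₀` of `Λ_f` has `dim_{K_f} R₀ ≤ 2`
(`IsNewform0.exists_submodule_coeffField_finrank_le_two`) and is stable under complex conjugation
(`conj_mem_periodLattice_of_im_eq_zero`, the coefficients being real, `IsNewform0.cuspCoeff_im_eq_zero`),
so `R₀ = re R₀ ⊕ i im R₀` with both summands nonzero `K_f`-subspaces because `Λ_f` spans `ℂ` over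
`ℝ` (`periodLattice_span_eq_top` of `ModularSymbolsLattice`); hence both are `K_f`-lines. [cite: Shimura1977, Thm. 1] -/
theorem IsNewform0.exists_re_im_mem_span_periodLattice (hf : IsNewform0 f) :
    ∃ Ωp Ωm : ℝ, Ωp ≠ 0 ∧ Ωm ≠ 0 ∧
      ∀ z ∈ Submodule.span (coeffField f) (periodLattice f : Set ℂ),
        (∃ q : ℂ, q ∈ coeffField f ∧ ((z.re : ℝ) : ℂ) = q * Ωp) ∧
        (∃ q : ℂ, q ∈ coeffField f ∧ ((z.im : ℝ) : ℂ) = q * Ωm) := by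
  set K : IntermediateField ℚ ℂ := coeffField f with hKdef
  have hK : ∀ x : K, (x : ℂ).im = 0 := fun x ↦ hf.im_eq_zero_of_mem_coeffField x.2
  have hKre : ∀ x : K, (((x : ℂ).re : ℝ) : ℂ) = x := fun x ↦
    Complex.ext (by simp) (by simp [hK x])
  have hreal : ∀ n, (cuspCoeff f n).im = 0 := hf.cuspCoeff_im_eq_zero
  have hf0 : f ≠ 0 := IsNormalized.ne_zero_gamma0 hf.2.2
  obtain ⟨R, hRfin, hR2, hΛR⟩ := hf.exists_submodule_coeffField_finrank_le_two
  set R₀ : Submodule K ℂ := Submodule.span K (periodLattice f : Set ℂ) with hR₀def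
  have hR₀R : R₀ ≤ R := Submodule.span_le.mpr hΛR
  haveI : FiniteDimensional K R₀ := Submodule.finiteDimensional_of_le hR₀R
  have hR₀2 : Module.finrank K R₀ ≤ 2 := (Submodule.finrank_mono hR₀R).trans hR2
  -- `R₀` is stable under complex conjugation
  have hconj : ∀ z ∈ R₀, conj z ∈ R₀ := by
    intro z hz
    induction hz using Submodule.span_induction with
    | mem x hx => exact Submodule.subset_span (conj_mem_periodLattice_of_im_eq_zero hreal hx)
    | zero => rw [map_zero]; exact zero_mem _
    | add x y _ _ hx hy => rw [map_add]; exact add_mem hx hy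
    | smul c x _ hx =>
      rw [IntermediateField.smul_def, smul_eq_mul, map_mul, Complex.conj_eq_iff_im.mpr (hK c),
        ← smul_eq_mul, ← IntermediateField.smul_def]
      exact Submodule.smul_mem _ c hx
  -- hence contains real and imaginary parts
  have h2K : (2⁻¹ : ℂ) ∈ K := inv_mem (natCast_mem K 2)
  have hre_mem : ∀ z ∈ R₀, ((z.re : ℝ) : ℂ) ∈ R₀ := by
    intro z hz
    have h2 : ((z.re : ℝ) : ℂ) = (⟨2⁻¹, h2K⟩ : K) • (z + conj z) := by
      rw [IntermediateField.smul_def, smul_eq_mul, Complex.add_conj]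
      change ((z.re : ℝ) : ℂ) = 2⁻¹ * (((2 * z.re : ℝ)) : ℂ)
      push_cast
      ring
    rw [h2]
    exact Submodule.smul_mem _ _ (add_mem hz (hconj z hz))
  have him_mem : ∀ z ∈ R₀, ((z.im : ℝ) : ℂ) * I ∈ R₀ := by
    intro z hz
    have h2 : ((z.im : ℝ) : ℂ) * I = (⟨2⁻¹, h2K⟩ : K) • (z - conj z) := by
      rw [IntermediateField.smul_def, smul_eq_mul, Complex.sub_conj]
      change ((z.im : ℝ) : ℂ) * I = 2⁻¹ * ((((2 * z.im : ℝ)) : ℂ) * I)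
      push_cast
      ring
    rw [h2]
    exact Submodule.smul_mem _ _ (sub_mem hz (hconj z hz))
  -- the `K`-linear maps `z ↦ re z`, `z ↦ i im z`
  let reK : ℂ →ₗ[K] ℂ :=
    { toFun := fun z ↦ ((z.re : ℝ) : ℂ)
      map_add' := fun x y ↦ by simp
      map_smul' := fun c z ↦ by
        rw [RingHom.id_apply, IntermediateField.smul_def, IntermediateField.smul_def, smul_eq_mul,
          smul_eq_mul]
        apply Complex.ext <;> simp [hK c] }
  let imK : ℂ →ₗ[K] ℂ :=
    { toFun := fun z ↦ ((z.im : ℝ) : ℂ) * I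
      map_add' := fun x y ↦ by simp only [Complex.add_im, Complex.ofReal_add]; ring
      map_smul' := fun c z ↦ by
        rw [RingHom.id_apply, IntermediateField.smul_def, IntermediateField.smul_def, smul_eq_mul,
          smul_eq_mul]
        apply Complex.ext <;> simp [hK c] }
  have hreK : ∀ z, reK z = ((z.re : ℝ) : ℂ) := fun z ↦ rfl
  have himK : ∀ z, imK z = ((z.im : ℝ) : ℂ) * I := fun z ↦ rfl
  set P : Submodule K ℂ := R₀.map reK with hPdef
  set Q : Submodule K ℂ := R₀.map imK with hQdef
  have hPR : P ≤ R₀ := by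
    rintro _ ⟨z, hz, rfl⟩
    exact hre_mem z hz
  have hQR : Q ≤ R₀ := by
    rintro _ ⟨z, hz, rfl⟩
    exact him_mem z hz
  haveI : FiniteDimensional K P := Submodule.finiteDimensional_of_le hPR
  haveI : FiniteDimensional K Q := Submodule.finiteDimensional_of_le hQR
  have hPim : ∀ x ∈ P, x.im = 0 := by
    rintro _ ⟨z, _, rfl⟩
    simp [hreK]
  have hQre : ∀ x ∈ Q, x.re = 0 := by
    rintro _ ⟨z, _, rfl⟩
    simp [himK]
  have hPQ : P ⊓ Q = ⊥ := by
    rw [eq_bot_iff]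
    intro x hx
    rw [Submodule.mem_bot]
    exact Complex.ext (by simpa using hQre x hx.2) (by simpa using hPim x hx.1)
  have hsum : Module.finrank K P + Module.finrank K Q ≤ 2 := by
    have h := Submodule.finrank_sup_add_finrank_inf_eq P Q
    rw [hPQ, finrank_bot, add_zero] at h
    rw [← h]
    exact (Submodule.finrank_mono (sup_le hPR hQR)).trans hR₀2
  -- both are nonzero, since `Λ_f` spans `ℂ` over `ℝ`
  have hspan := periodLattice_span_eq_top f hf0
  have hP0 : P ≠ ⊥ := by
    intro hP
    have hker : Submodule.span ℝ (periodLattice f : Set ℂ) ≤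
        LinearMap.ker Complex.reLm := by
      rw [Submodule.span_le]
      intro z hz
      rw [SetLike.mem_coe, LinearMap.mem_ker, Complex.reLm_coe]
      have hzP : reK z ∈ P := ⟨z, Submodule.subset_span hz, rfl⟩
      rw [hP, Submodule.mem_bot, hreK] at hzP
      exact_mod_cast hzP
    rw [hspan] at hker
    have h1 : (1 : ℂ) ∈ LinearMap.ker Complex.reLm := hker trivial
    simp at h1
  have hQ0 : Q ≠ ⊥ := by
    intro hQ
    have hker : Submodule.span ℝ (periodLattice f : Set ℂ) ≤
        LinearMap.ker Complex.imLm := by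
      rw [Submodule.span_le]
      intro z hz
      rw [SetLike.mem_coe, LinearMap.mem_ker, Complex.imLm_coe]
      have hzQ : imK z ∈ Q := ⟨z, Submodule.subset_span hz, rfl⟩
      rw [hQ, Submodule.mem_bot, himK] at hzQ
      have := mul_eq_zero.mp hzQ
      rcases this with h | h
      · exact_mod_cast h
      · exact absurd h Complex.I_ne_zero
    rw [hspan] at hker
    have h1 : (I : ℂ) ∈ LinearMap.ker Complex.imLm := hker trivial
    simp at h1
  have hP1 : 1 ≤ Module.finrank K P := Submodule.one_le_finrank_iff.mpr hP0
  have hQ1 : 1 ≤ Module.finrank K Q := Submodule.one_le_finrank_iff.mpr hQ0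
  have hPeq : Module.finrank K P = 1 := by omega
  have hQeq : Module.finrank K Q = 1 := by omega
  obtain ⟨v, hv0, hv⟩ := finrank_eq_one_iff'.mp hPeq
  obtain ⟨u, hu0, hu⟩ := finrank_eq_one_iff'.mp hQeq
  -- `v = Ω⁺` is real, `u = i Ω⁻` purely imaginary
  have hvre : (((v : ℂ).re : ℝ) : ℂ) = v := Complex.ext (by simp) (by simp [hPim _ v.2])
  have huim : (((u : ℂ).im : ℝ) : ℂ) * I = u := Complex.ext (by simp [hQre _ u.2]) (by simp)
  refine ⟨(v : ℂ).re, (u : ℂ).im, ?_, ?_, fun z hz ↦ ⟨?_, ?_⟩⟩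
  · intro h
    apply hv0
    exact Subtype.ext (by rw [← hvre, h]; simp)
  · intro h
    apply hu0
    exact Subtype.ext (by rw [← huim, h]; simp)
  · obtain ⟨c, hc⟩ := hv ⟨reK z, ⟨z, hz, rfl⟩⟩
    refine ⟨c, c.2, ?_⟩
    have h := congrArg Subtype.val hc
    simp only [Submodule.coe_smul, IntermediateField.smul_def, smul_eq_mul] at h
    rw [hreK] at h
    rw [← h, hvre]
  · obtain ⟨c, hc⟩ := hu ⟨imK z, ⟨z, hz, rfl⟩⟩
    refine ⟨c, c.2, ?_⟩
    have h := congrArg Subtype.val hc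
    simp only [Submodule.coe_smul, IntermediateField.smul_def, smul_eq_mul] at h
    rw [himK, ← huim, ← mul_assoc] at h
    exact (mul_right_cancel₀ Complex.I_ne_zero h).symm

/-- **Modular symbols lie in the `K_f`-span of the periods** (Manin–Drinfeld,
`exists_nsmul_modularSymbol_mem_periodLattice_holds`: `n {∞, r}_f ∈ Λ_f` for some `n ≥ 1`). [cite: Manin1972, Cor. 3.6] -/
theorem modularSymbol_mem_span_periodLattice (K : IntermediateField ℚ ℂ) (r : ℚ) :
    modularSymbol f r ∈ Submodule.span K (periodLattice f : Set ℂ) := by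
  obtain ⟨n, hn, hmem⟩ := exists_nsmul_modularSymbol_mem_periodLattice_holds f r
  have hn0 : (n : ℂ) ≠ 0 := by exact_mod_cast hn.ne'
  have hnK : ((n : ℂ))⁻¹ ∈ K := inv_mem (natCast_mem K n)
  have h : modularSymbol f r = (⟨(n : ℂ)⁻¹, hnK⟩ : K) • (n • modularSymbol f r) := by
    rw [IntermediateField.smul_def, smul_eq_mul, nsmul_eq_mul]
    change modularSymbol f r = (n : ℂ)⁻¹ * ((n : ℂ) * modularSymbol f r)
    rw [← mul_assoc, inv_mul_cancel₀ hn0, one_mul]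
  rw [h]
  exact Submodule.smul_mem _ _ (Submodule.subset_span hmem)

/-- **Shimura's theorem for the plus symbols of a newform** (Shimura 1977, Thm. 1, even
characters / `K_f = ℚ`: Manin 1972, Cor. 3.6 with Thm. 1.9, `IsNewform0.exists_rat_smul_plusPeriod`):
for a normalised newform `f ∈ S₂(Γ₀(N))` there is a real `Ω⁺ ≠ 0` with
`plusSymbol f r = ({∞, r}_f + {∞, -r}_f)/2 ∈ K_f · Ω⁺` for every rational `r`.
[cite: Shimura1977, Thm. 1] -/
theorem IsNewform0.exists_plusSymbol_eq_mul (hf : IsNewform0 f) :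
    ∃ Ω : ℝ, Ω ≠ 0 ∧ ∀ r : ℚ, ∃ q : ℂ, q ∈ coeffField f ∧ plusSymbol f r = q * Ω := by
  obtain ⟨Ωp, Ωm, hp, -, h⟩ := hf.exists_re_im_mem_span_periodLattice
  refine ⟨Ωp, hp, fun r ↦ ?_⟩
  obtain ⟨⟨q, hq, hqe⟩, -⟩ := h _ (modularSymbol_mem_span_periodLattice (coeffField f) r)
  exact ⟨q, hq, by rw [plusSymbol_eq_re_holds f hf.cuspCoeff_im_eq_zero r, hqe]⟩

/-- **Shimura's theorem for the minus symbols of a newform** (Shimura 1977, Thm. 1, odd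
characters / `K_f = ℚ`: `IsNewform0.exists_rat_smul_minusPeriod`): for a normalised newform
`f ∈ S₂(Γ₀(N))` there is a real `Ω⁻ ≠ 0` with
`minusSymbol f r = ({∞, r}_f - {∞, -r}_f)/2 ∈ K_f · iΩ⁻` for every rational `r`.
[cite: Shimura1977, Thm. 1] -/
theorem IsNewform0.exists_minusSymbol_eq_mul (hf : IsNewform0 f) :
    ∃ Ω : ℝ, Ω ≠ 0 ∧ ∀ r : ℚ, ∃ q : ℂ, q ∈ coeffField f ∧ minusSymbol f r = q * Ω * I := by
  obtain ⟨Ωp, Ωm, -, hm, h⟩ := hf.exists_re_im_mem_span_periodLattice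
  refine ⟨Ωm, hm, fun r ↦ ?_⟩
  obtain ⟨-, ⟨q, hq, hqe⟩⟩ := h _ (modularSymbol_mem_span_periodLattice (coeffField f) r)
  exact ⟨q, hq, by rw [minusSymbol_eq_im_mul_I_holds f hf.cuspCoeff_im_eq_zero r, hqe]⟩

/-- **Shimura's theorem for the periods of a newform** (Shimura 1977, Thm. 1; Cremona 1997,
(2.10.1) for `K_f = ℚ`: "`⟨γ, f⟩ = (v⁺γ) x + (v⁻γ) y i`"): every period `{∞, γ∞}_f`, `γ ∈ Γ₀(N)`,
and every modular symbol `{∞, r}_f`, `r ∈ ℚ`, of a normalised newform `f ∈ S₂(Γ₀(N))` is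
`q⁺ Ω⁺ + q⁻ Ω⁻ i` with `q^± ∈ K_f`, for two fixed real numbers `Ω^± ≠ 0`. [cite: Shimura1977, Thm. 1] -/
theorem IsNewform0.exists_periods_eq_add_mul_I (hf : IsNewform0 f) :
    ∃ Ωp Ωm : ℝ, Ωp ≠ 0 ∧ Ωm ≠ 0 ∧
      (∀ γ : Gamma0 N, ∃ qp qm : ℂ, qp ∈ coeffField f ∧ qm ∈ coeffField f ∧
        cuspSymbol f γ = qp * Ωp + qm * Ωm * I) ∧
      (∀ r : ℚ, ∃ qp qm : ℂ, qp ∈ coeffField f ∧ qm ∈ coeffField f ∧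
        modularSymbol f r = qp * Ωp + qm * Ωm * I) := by
  obtain ⟨Ωp, Ωm, hp, hm, h⟩ := hf.exists_re_im_mem_span_periodLattice
  have key : ∀ z ∈ Submodule.span (coeffField f) (periodLattice f : Set ℂ),
      ∃ qp qm : ℂ, qp ∈ coeffField f ∧ qm ∈ coeffField f ∧ z = qp * Ωp + qm * Ωm * I := by
    intro z hz
    obtain ⟨⟨qp, hqp, hpe⟩, ⟨qm, hqm, hme⟩⟩ := h z hz
    refine ⟨qp, qm, hqp, hqm, ?_⟩
    rw [← hpe, ← hme]
    exact (Complex.re_add_im z).symm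
  exact ⟨Ωp, Ωm, hp, hm,
    fun γ ↦ key _ (Submodule.subset_span (cuspSymbol_mem_periodLattice f γ)),
    fun r ↦ key _ (modularSymbol_mem_span_periodLattice (coeffField f) r)⟩

end NewformPeriods

end Literature.NumberTheory.EllipticCurves.ModularForms
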